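import Summits.QuantumFields.YangMills.Theorems.BalabanUVNodesN07Thm4RecMember152OfCrown
import Summits.QuantumFields.YangMills.Theorems.BalabanUVNodesN07Thm4RecMemberOfRecordCrownSU
import HarnessLib

/-!
# N07 [B11] (= [15] = [Balaban1985Variational]) Sect. F — **`HThm4RecMember152` AT THE PRINT LETTERS AND FROM THE TREE: the junction END TO END WITH (T2b)** (pen (j-iii) of plan
# g93's WORD A3⁵ = ρ3 «φ-form», last link): ✓p729805's print-letter packaging VERBATIM for `HThm4RecMember152`, then ✓p735717's adapter and ✓p739534∕✓p740700's SU bridge ⇒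
# ★★★ `hThm4RecMember152_uniform_holds(_of_le)` — `HThm4RecMember` + [15] (152) member 2 at every level, for every `Mc`, `N ≤ 12` ∕ `N ≤ 25`, collar-uniformly, NO R6 premise

Cell `pub-ymgap`, width seat `pub-ymgap-dag-n07-w3` g12.  `--kind proof --supports stmt-QuantumFields-20541 --as helper` (K0⁷; count-neutral).  Theorems only; CONSUMED BY NAME,
nothing modified: ✓p729805 (`b9OfP_twenty`, `a0OfP_le_first∕_second`, `le_mul_collar`), ✓p735717 (`datumCrownAt_of_recordCrownSUBody`), ✓p739534∕✓p740700
(`recordCrownSU_holds(_of_le)`), this seat's `…Thm4RecMember152OfCrown.hThm4RecMember152_of_datumCrownAt`.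
[6] = [Balaban1985RegularSpaces]; [15] = [Balaban1985Variational]; [I] = [Balaban1987RG1].

WHAT IS PROVED (kernel; composition by name + the arithmetic of ✓p729805 verbatim).
* §1 ★★ `hThm4RecMember152_printLetters_of_datumCrownAt(_sideP)` ∕ ★★ `…_uniform_of_datumCrownAt(_sideP)` — ✓p729805 §2–§3 with `HThm4RecMember ↦ HThm4RecMember152`.
* §2 ★★★ `hThm4RecMember152_uniform_holds (hN : N ≤ 12) (Mc)` ∕ ★★★ `hThm4RecMember152_uniform_holds_of_le (hN : N ≤ 25) (Mc)` :
  `∃ ρmin B₁ c₁′, 1 ≤ ρmin ∧ 0 ≤ B₁ ∧ 0 < c₁′ ∧ ∀ ρ₀, ρmin ∣ ρ₀ → 1 ≤ ρ₀ → ∀ hρ, HThm4RecMember152 F N Mc (ρ₀·L) hρ (b9OfP F Mc (ρ₀·L) B₁) (a0OfP F N Mc (ρ₀·L) B₁ c₁′)`.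
HONEST FRAMING: count-neutral; the junction now pays rows 1–8 of the N07 head's Thm-4 premise PLUS (T2b) from the tree; the `Nrm` row 9′ (sym currency, pens (j-i)(j-ii)) is NOT
produced ⇒ `HThm4RecSym152` ∕ `HThm4Rec(Dbar)` UNDISCHARGED (caveat (C-S3-1)); N05 ∕ N07 NOT discharged; K0⁷ ∕ K1⁹ NOT closed; counts unmoved (typed 28∕28 · discharged 8∕27); one
finite 𝕋⁴ programme at fixed ε — R4 closes the conditional finite-𝕋⁴ rung `BalabanLadder.UV` ONLY; the YM mass gap (Clay) is NOT proved by any of this; nothing continuum ∕ ℝ⁴ ∕ OS.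

References: [6] Thm. 4 p. 88, Prop. 6 (1.130)–(1.138) pp. 98–99; [15] (144) p. 300, (152)–(153) p. 301, (163) p. 304; [I] (0.4) p. 253, (0.11) pp. 253–254.
-/

noncomputable section

open scoped BigOperators Matrix.Norms.L2Operator

namespace Summit.QuantumFields.YangMills.BalabanUVNodes.N07Thm4RecMember152OfRecordCrownSU


open Literature.MathematicalPhysics.QuantumFieldTheory.Balaban1983to89
open Literature.MathematicalPhysics.QuantumFieldTheory.Balaban1983to89.Node00
open T4Continuum (T4Family)
open Summit.QuantumFields.YangMills.BalabanUVNodes.N07Thm4RecMemberOfCrown (DatumCrownAt HThm4RecMember)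
open Summit.QuantumFields.YangMills.BalabanUVNodes.N07Thm4RecMember152OfCrown (HThm4RecMember152 hThm4RecMember152_of_datumCrownAt)
open Summit.QuantumFields.YangMills.BalabanUVNodes.N07Thm4RecMemberPrintLetters (b9OfP_twenty a0OfP_le_first a0OfP_le_second le_mul_collar)
open Summit.QuantumFields.YangMills.BalabanUVNodes.N07DatumCrownOfRecordCrown (RecordCrownSU RecordCrownSUBody datumCrownAt_of_recordCrownSUBody)
open Summit.QuantumFields.YangMills.BalabanUVNodes.N07Thm4RecMemberOfRecordCrownSU (recordCrownSU_holds recordCrownSU_holds_of_le)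

variable (F : T4Family) (N : ℕ) [NeZero N]

/-! ## §1  ✓p729805's print-letter packaging for `HThm4RecMember152` -/

/-- ★★ **`HThm4RecMember` AT THE PRINT LETTERS `b9OfP ∕ a0OfP` FROM THE DATUM CROWN**: if R6's crown holds at the print datum with a radius constant `0 ≤ Cr ≤ 560·L³·B₀·(L·Mc + 44 + 2ρ)`
(= [6] Prop. 6's `7·d·L²·(5dLB₀)·M′` at `d = 4`, `M′ ≤ L·Mc + 44 + 2ρ`) and a tolerance ceiling `α₁ ≥ c₁ ∕ (56·L²·(L·Mc + 44 + 2ρ))` (⊒ the guard «`7dL²·M′·α₀ ≤ c₁`»), then the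
member-row premise holds at [15] (152)'s letter `κ := b9OfP F Mc ρ (20·L⁴·B₀)` and ceiling `a₀ := a0OfP F N Mc ρ (20·L⁴·B₀) c₁` — p721358's `hThm4RecMember_of_datumCrownAt` with its
three side conditions discharged by real arithmetic: `4·Cr·L⁶ ≤ b9OfP − 1`, `L³·a₀ ≤ c₁∕(56L²S′) ≤ α₁`, `4N·Cr·L³·a₀ ≤ 1 < 2π`.
[cite: Balaban1985RegularSpaces, Prop. 6 (1.130)–(1.138) p.99; Balaban1985Variational, (152)–(153) p.301; Balaban1987RG1, (0.4) p.253] -/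
theorem hThm4RecMember152_printLetters_of_datumCrownAt {Mc ρ : ℕ} (hρ : F.L ≤ ρ) {Cr α₁ B₀ c₁ : ℝ} (hB₀ : 0 < B₀) (hc₁ : 0 < c₁) (hCr : 0 ≤ Cr)
    (hCrB : Cr ≤ 560 * (F.L : ℝ) ^ 3 * B₀ * ((F.L * Mc + 44 + 2 * ρ : ℕ) : ℝ))
    (hα₁ : c₁ / (56 * (F.L : ℝ) ^ 2 * ((F.L * Mc + 44 + 2 * ρ : ℕ) : ℝ)) ≤ α₁)
    (hcrown : DatumCrownAt F N Mc ρ hρ Cr α₁) :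
    HThm4RecMember152 F N Mc ρ hρ (b9OfP F Mc ρ (20 * (F.L : ℝ) ^ 4 * B₀)) (a0OfP F N Mc ρ (20 * (F.L : ℝ) ^ 4 * B₀) c₁) := by
  set S : ℝ := ((F.L * Mc + 44 + 2 * ρ : ℕ) : ℝ) with hS
  set L : ℝ := (F.L : ℝ) with hLdef
  set a₀ : ℝ := a0OfP F N Mc ρ (20 * L ^ 4 * B₀) c₁ with ha₀
  have hL1 : (1 : ℝ) ≤ L := by rw [hLdef]; exact_mod_cast (F.P 0).L_pos
  have hL0 : (0 : ℝ) < L := by linarith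
  have hS44 : (44 : ℝ) ≤ S := by
    rw [hS]; push_cast
    have h1 : (0 : ℝ) ≤ (F.L : ℝ) * (Mc : ℝ) := by positivity
    have h2 : (0 : ℝ) ≤ (ρ : ℝ) := by positivity
    linarith
  have hS0 : (0 : ℝ) < S := by linarith
  have hN0 : (0 : ℝ) ≤ N := Nat.cast_nonneg N
  have hB₁ : (0 : ℝ) ≤ 20 * L ^ 4 * B₀ := by positivity
  have ha₀0 : 0 ≤ a₀ := (a0OfP_pos (F := F) (N := N) Mc ρ hB₁ hc₁).le
  -- (i) the (152)-letter: `4·Cr·L⁶ < b9OfP`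
  have hκ : 4 * Cr * L ^ 6 < b9OfP F Mc ρ (20 * L ^ 4 * B₀) := by
    rw [b9OfP_twenty]
    have h1 : 4 * Cr * L ^ 6 ≤ 4 * (560 * L ^ 3 * B₀ * S) * L ^ 6 := by gcongr
    have h2 : 4 * (560 * L ^ 3 * B₀ * S) * L ^ 6 = 2240 * L ^ 9 * B₀ * S := by ring
    linarith
  -- (ii) the tolerance ceiling: `L³·a₀ ≤ α₁`
  have hα : L ^ 3 * a₀ ≤ α₁ := by
    have h1 : a₀ ≤ c₁ / (56 * L ^ 5 * S) := a0OfP_le_first F N Mc ρ _ c₁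
    have h2 : L ^ 3 * a₀ ≤ L ^ 3 * (c₁ / (56 * L ^ 5 * S)) := mul_le_mul_of_nonneg_left h1 (by positivity)
    have h3 : L ^ 3 * (c₁ / (56 * L ^ 5 * S)) = c₁ / (56 * L ^ 2 * S) := by
      field_simp
    linarith [h3 ▸ h2]
  -- (iii) the `2π` window: `4N·Cr·L³·a₀ ≤ 1 < 2π`
  have hwin : 4 * ((N : ℝ) * (Cr * (L ^ 3 * a₀))) < 2 * Real.pi := by
    set D : ℝ := 8 * S * N * (28 * L ^ 5 * (20 * L ^ 4 * B₀) * S) + 1 with hD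
    have hD0 : 0 < D := by positivity
    have h1 : a₀ ≤ 1 / D := a0OfP_le_second F N Mc ρ _ c₁
    have hX0 : 0 ≤ 2240 * (N : ℝ) * L ^ 6 * B₀ * S := by positivity
    have h2 : 4 * ((N : ℝ) * (Cr * (L ^ 3 * a₀))) ≤ 2240 * (N : ℝ) * L ^ 6 * B₀ * S * a₀ := by
      have : (N : ℝ) * (Cr * (L ^ 3 * a₀)) ≤ (N : ℝ) * (560 * L ^ 3 * B₀ * S * (L ^ 3 * a₀)) := by
        apply mul_le_mul_of_nonneg_left _ hN0
        exact mul_le_mul_of_nonneg_right hCrB (by positivity)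
      nlinarith [this]
    have h3 : 2240 * (N : ℝ) * L ^ 6 * B₀ * S * a₀ ≤ 2240 * (N : ℝ) * L ^ 6 * B₀ * S * (1 / D) := mul_le_mul_of_nonneg_left h1 hX0
    have h4 : 2240 * (N : ℝ) * L ^ 6 * B₀ * S ≤ D := by
      have hLS : (1 : ℝ) ≤ L ^ 3 * S := by
        have : (1 : ℝ) ≤ L ^ 3 := one_le_pow₀ hL1
        nlinarith
      have : 2240 * (N : ℝ) * L ^ 6 * B₀ * S * 1 ≤ 2240 * (N : ℝ) * L ^ 6 * B₀ * S * (2 * (L ^ 3 * S)) :=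
        mul_le_mul_of_nonneg_left (by linarith) hX0
      have hD' : D = 2240 * (N : ℝ) * L ^ 6 * B₀ * S * (2 * (L ^ 3 * S)) + 1 := by rw [hD]; ring
      linarith
    have h5 : 2240 * (N : ℝ) * L ^ 6 * B₀ * S * (1 / D) ≤ 1 := by
      rw [mul_one_div]; exact div_le_one_of_le₀ h4 hD0.le
    have hπ : (1 : ℝ) < 2 * Real.pi := by linarith [Real.pi_gt_three]
    linarith
  exact hThm4RecMember152_of_datumCrownAt hρ hCr hcrown hκ hα hwin

/-- ★ **The same at the crown's OWN constants** `Cr := 560·L³·B₀·M′` (= `7·d·L²·(5dLB₀)·M′`, `d = 4`) and `α₁ := c₁ ∕ (28·L²·M′)` (= the guard «`7dL²·M′·α₀ ≤ c₁`»), `M′ = sideP (F.P 0) Mc ρ`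
(the print side of the datum, `M′ ≤ Mc + 44 + 2ρ ≤ L·Mc + 44 + 2ρ` by `sideP_le`). [cite: Balaban1985RegularSpaces, Prop. 6 (1.130), (1.135)–(1.138) p.99, p.98 («M is a multiple of R₁M₁»); Balaban1985Variational, (152)–(153) p.301] -/
theorem hThm4RecMember152_printLetters_of_datumCrownAt_sideP {Mc ρ : ℕ} (hρ : F.L ≤ ρ) {B₀ c₁ : ℝ} (hB₀ : 0 < B₀) (hc₁ : 0 < c₁)
    (hcrown : DatumCrownAt F N Mc ρ hρ (560 * (F.L : ℝ) ^ 3 * B₀ * (sideP (F.P 0) Mc ρ : ℝ)) (c₁ / (28 * (F.L : ℝ) ^ 2 * (sideP (F.P 0) Mc ρ : ℝ)))) :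
    HThm4RecMember152 F N Mc ρ hρ (b9OfP F Mc ρ (20 * (F.L : ℝ) ^ 4 * B₀)) (a0OfP F N Mc ρ (20 * (F.L : ℝ) ^ 4 * B₀) c₁) := by
  have hL1 : 1 ≤ F.L := (F.P 0).L_pos
  have hLr : (1 : ℝ) ≤ F.L := by exact_mod_cast hL1
  have hρ0 : 0 < ρ := lt_of_lt_of_le hL1 hρ
  have hsd : sideP (F.P 0) Mc ρ ≤ F.L * Mc + 44 + 2 * ρ := by
    have h := sideP_le (P := F.P 0) Mc ρ
    have hd : (F.P 0).d = 4 := T4Family.P_d F 0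
    rw [hd] at h
    have : Mc ≤ F.L * Mc := Nat.le_mul_of_pos_left Mc hL1
    omega
  have hsd1 : 1 ≤ sideP (F.P 0) Mc ρ := by
    have h := le_sideP (P := F.P 0) Mc hρ0
    omega
  have hsdR : (sideP (F.P 0) Mc ρ : ℝ) ≤ ((F.L * Mc + 44 + 2 * ρ : ℕ) : ℝ) := by exact_mod_cast hsd
  have hsd0 : (0 : ℝ) < (sideP (F.P 0) Mc ρ : ℝ) := by exact_mod_cast hsd1
  refine hThm4RecMember152_printLetters_of_datumCrownAt F N hρ hB₀ hc₁ (by positivity) ?_ ?_ hcrown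
  · exact mul_le_mul_of_nonneg_left hsdR (by positivity)
  · -- `c₁ ∕ (56·L²·S′) ≤ c₁ ∕ (28·L²·M′)` since `28·L²·M′ ≤ 56·L²·S′`
    apply div_le_div_of_nonneg_left hc₁.le (by positivity)
    nlinarith [hsdR, hsd0, sq_nonneg (F.L : ℝ)]

/-! ## §3  The collar-uniform shape (MODULE 88″ §2's quantifiers, `HThm4RecDbar ↦ HThm4RecMember`) -/

/-- ★★ **THE COLLAR-UNIFORM MEMBER-ROW PREMISE FROM THE DATUM CROWN AT EVERY ADMISSIBLE COLLAR**: if for every `ρ₀ ≥ 1` with `ρmin ∣ ρ₀` the datum crown holds at the collar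
`ρ₀·L` with a radius constant `0 ≤ Cr ρ₀ ≤ 560·L³·B₀·(L·Mc + 44 + 2ρ₀L)` and a ceiling `α₁ ρ₀ ≥ c₁ ∕ (56·L²·(L·Mc + 44 + 2ρ₀L))` (`B₀, c₁` UNIFORM — [6] Prop. 6 p. 99 «there exist
constants B₁, c₁» over the big-block class), then ONE witness `(B₁, c₁′) := (20·L⁴·B₀, c₁)` gives the member-row premise at the print letters at every such collar — the text of
dag-n07-e's `HThm4RecDbarUniform F N Mc` (88″ §2) with `HThm4RecDbar ↦ HThm4RecMember` (the K0 assembler picks the collar AFTER `B₁`, as print does at [15] (163)).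
[cite: Balaban1985RegularSpaces, Prop. 6 p.99, Thm. 4 p.88; Balaban1985Variational, (144) p.300, (152) p.301, (163) p.304; Balaban1987RG1, (0.11) pp.253–254] -/
theorem hThm4RecMember152_printLetters_uniform_of_datumCrownAt {Mc ρmin : ℕ} {B₀ c₁ : ℝ} (hB₀ : 0 < B₀) (hc₁ : 0 < c₁) (Cr α₁ : ℕ → ℝ)
    (hCr : ∀ ρ₀, 0 ≤ Cr ρ₀) (hCrB : ∀ ρ₀, Cr ρ₀ ≤ 560 * (F.L : ℝ) ^ 3 * B₀ * ((F.L * Mc + 44 + 2 * (ρ₀ * F.L) : ℕ) : ℝ))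
    (hα₁ : ∀ ρ₀, c₁ / (56 * (F.L : ℝ) ^ 2 * ((F.L * Mc + 44 + 2 * (ρ₀ * F.L) : ℕ) : ℝ)) ≤ α₁ ρ₀)
    (hall : ∀ ρ₀, ρmin ∣ ρ₀ → 1 ≤ ρ₀ → ∀ hρ : F.L ≤ ρ₀ * F.L, DatumCrownAt F N Mc (ρ₀ * F.L) hρ (Cr ρ₀) (α₁ ρ₀)) :
    ∃ B₁ c₁' : ℝ, 0 ≤ B₁ ∧ 0 < c₁' ∧ ∀ ρ₀ : ℕ, ρmin ∣ ρ₀ → 1 ≤ ρ₀ → ∀ hρ : F.L ≤ ρ₀ * F.L,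
      HThm4RecMember152 F N Mc (ρ₀ * F.L) hρ (b9OfP F Mc (ρ₀ * F.L) B₁) (a0OfP F N Mc (ρ₀ * F.L) B₁ c₁') := by
  refine ⟨20 * (F.L : ℝ) ^ 4 * B₀, c₁, by positivity, hc₁, fun ρ₀ hd h1 hρ => ?_⟩
  exact hThm4RecMember152_printLetters_of_datumCrownAt F N hρ hB₀ hc₁ (hCr ρ₀) (hCrB ρ₀) (hα₁ ρ₀) (hall ρ₀ hd h1 hρ)

/-- ★ **The collar-uniform shape at the crown's own constants** (`Cr := 560·L³·B₀·M′(ρ₀L)`, `α₁ := c₁ ∕ (28·L²·M′(ρ₀L))`, `M′(ρ) = sideP (F.P 0) Mc ρ`): from the datum crown at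
every admissible collar, ONE witness `(20·L⁴·B₀, c₁)` for 88″ §2's quantifiers with `HThm4RecDbar ↦ HThm4RecMember`. [cite: Balaban1985RegularSpaces, Prop. 6 (1.130)–(1.138) p.99; Balaban1985Variational, (152) p.301, (163) p.304; Balaban1987RG1, (0.11) pp.253–254] -/
theorem hThm4RecMember152_printLetters_uniform_of_datumCrownAt_sideP {Mc ρmin : ℕ} {B₀ c₁ : ℝ} (hB₀ : 0 < B₀) (hc₁ : 0 < c₁)
    (hall : ∀ ρ₀, ρmin ∣ ρ₀ → 1 ≤ ρ₀ → ∀ hρ : F.L ≤ ρ₀ * F.L,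
      DatumCrownAt F N Mc (ρ₀ * F.L) hρ (560 * (F.L : ℝ) ^ 3 * B₀ * (sideP (F.P 0) Mc (ρ₀ * F.L) : ℝ)) (c₁ / (28 * (F.L : ℝ) ^ 2 * (sideP (F.P 0) Mc (ρ₀ * F.L) : ℝ)))) :
    ∃ B₁ c₁' : ℝ, 0 ≤ B₁ ∧ 0 < c₁' ∧ ∀ ρ₀ : ℕ, ρmin ∣ ρ₀ → 1 ≤ ρ₀ → ∀ hρ : F.L ≤ ρ₀ * F.L,
      HThm4RecMember152 F N Mc (ρ₀ * F.L) hρ (b9OfP F Mc (ρ₀ * F.L) B₁) (a0OfP F N Mc (ρ₀ * F.L) B₁ c₁') := by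
  refine ⟨20 * (F.L : ℝ) ^ 4 * B₀, c₁, by positivity, hc₁, fun ρ₀ hd h1 hρ => ?_⟩
  exact hThm4RecMember152_printLetters_of_datumCrownAt_sideP F N hρ hB₀ hc₁ (hall ρ₀ hd h1 hρ)

/-! ## §2  From the tree: the junction END TO END with (T2b) -/

/-- ★★★ **THE N05-REC → K-ROAD JUNCTION WITH (T2b), END TO END (`N ≤ 12`)**: for every grid side `Mc`, a collar modulus `ρmin ≥ 1` and ONE witness `(B₁, c₁′)` with
`HThm4RecMember152 F N Mc (ρ₀·L) hρ (b9OfP …) (a0OfP …)` at every admissible collar — from the tree's theorems only (R1–R8, Cov facts, the `_grad` door chain, knit, adapter, SU bridge).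
[cite: Balaban1985RegularSpaces, Thm. 4 p.88, Prop. 6 (1.130)–(1.138) pp.98–99; Balaban1985Variational, (144) p.300, (152)–(153) p.301, (163) p.304; Balaban1987RG1, (0.4) p.253, (0.11) pp.253–254] -/
theorem hThm4RecMember152_uniform_holds (hN : N ≤ 12) (Mc : ℕ) :
    ∃ ρmin : ℕ, ∃ B₁ c₁' : ℝ, 1 ≤ ρmin ∧ 0 ≤ B₁ ∧ 0 < c₁' ∧ ∀ ρ₀ : ℕ, ρmin ∣ ρ₀ → 1 ≤ ρ₀ → ∀ hρ : F.L ≤ ρ₀ * F.L,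
      HThm4RecMember152 F N Mc (ρ₀ * F.L) hρ (b9OfP F Mc (ρ₀ * F.L) B₁) (a0OfP F N Mc (ρ₀ * F.L) B₁ c₁') := by
  obtain ⟨B₀, c₁, ρ₀, M₀, N₀, R₀, hB₀, hc₁, hbody⟩ := recordCrownSU_holds F N hN
  obtain ⟨ρmin, hρmin, hall⟩ := datumCrownAt_of_recordCrownSUBody F N hbody Mc
  obtain ⟨B₁, c₁', hB₁, hc₁', hmem⟩ :=
    hThm4RecMember152_printLetters_uniform_of_datumCrownAt_sideP F N (Mc := Mc) (ρmin := ρmin) (lt_of_lt_of_le one_pos hB₀) hc₁ hall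
  exact ⟨ρmin, B₁, c₁', hρmin, hB₁, hc₁', hmem⟩

/-- ★★★ **THE SAME FOR `N ≤ 25`** (dag-n05-e g41's sharp record `SU(N)` closure, ✓p739612 ∕ ✓p740700).
[cite: Balaban1985RegularSpaces, Thm. 4 p.88, Prop. 6 (1.130)–(1.138) pp.98–99, p.76; Balaban1985Variational, (152)–(153) p.301; Balaban1985Averaging, (22)–(23) p.21; Balaban1987RG1, (0.4) p.253] -/
theorem hThm4RecMember152_uniform_holds_of_le (hN : N ≤ 25) (Mc : ℕ) :
    ∃ ρmin : ℕ, ∃ B₁ c₁' : ℝ, 1 ≤ ρmin ∧ 0 ≤ B₁ ∧ 0 < c₁' ∧ ∀ ρ₀ : ℕ, ρmin ∣ ρ₀ → 1 ≤ ρ₀ → ∀ hρ : F.L ≤ ρ₀ * F.L,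
      HThm4RecMember152 F N Mc (ρ₀ * F.L) hρ (b9OfP F Mc (ρ₀ * F.L) B₁) (a0OfP F N Mc (ρ₀ * F.L) B₁ c₁') := by
  obtain ⟨B₀, c₁, ρ₀, M₀, N₀, R₀, hB₀, hc₁, hbody⟩ := recordCrownSU_holds_of_le F N hN
  obtain ⟨ρmin, hρmin, hall⟩ := datumCrownAt_of_recordCrownSUBody F N hbody Mc
  obtain ⟨B₁, c₁', hB₁, hc₁', hmem⟩ :=
    hThm4RecMember152_printLetters_uniform_of_datumCrownAt_sideP F N (Mc := Mc) (ρmin := ρmin) (lt_of_lt_of_le one_pos hB₀) hc₁ hall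
  exact ⟨ρmin, B₁, c₁', hρmin, hB₁, hc₁', hmem⟩

end Summit.QuantumFields.YangMills.BalabanUVNodes.N07Thm4RecMember152OfRecordCrownSU

end

/-! ## Axiom audit (gate whitelist: `propext`, `Classical.choice`, `Quot.sound`) -/
#print axioms Summit.QuantumFields.YangMills.BalabanUVNodes.N07Thm4RecMember152OfRecordCrownSU.hThm4RecMember152_uniform_holds_of_le
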